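import Literature.Analysis.FluidPDE.ElgindiLocalPartCoercivity
import Literature.Analysis.FluidPDE.ElgindiH1Coercivity
import HarnessLib

/-!
# The `𝓗¹`-block pairing of [Elgindi2021] Definition 6.10 as a bilinear functional, and its
Cauchy–Schwarz bounds

Topic `Literature/Analysis/FluidPDE`. Support file (five definitions with bodies, everything
proved; no named facts) on the proof path of the named fact
`Literature.Analysis.FluidPDE.Elgindi.ElgindiGhoulMasmoudi2021_stabilityCore`
(`ElgindiStabilityDecomposition.lean`). T. M. Elgindi, Ann. of Math. 194 (2021) =
arXiv:1904.04795, §6.2 Definition 6.10 ("`(f,g)_{𝓗¹} = 10((D_zf),(D_zg)w²/sin(2θ)^η) +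
10¹⁰(fw,gw/sin(2θ)^η) + 10¹⁷(fw,gw) + 10²¹((D_θf),(D_θg)w²/sin(2θ)^γ)`") and §6.3 proof of
Proposition 6.13 ("`(E₁, D_θf)_{𝓗^{k−1}} ≥ … − C_{k−1}|E₁|_{𝓗^{k−1}}|D_θf|_{𝓗^{k−1}}`": the
Cauchy–Schwarz step of the induction).

Definitions: the weighted pairings `pairW ρ v u = ∬_strip v·u·w²ρ(θ)`, the weighted squares
`sqW ρ u = ∬_strip (uw)²ρ(θ)`, the two angular weights `wEta = sin(2θ)^{−η}`, `wGam α = sin(2θ)^{−γ}`,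
and the block `blockPair α v u = 10·pairW wEta (D_zv)(D_zu) + 10¹⁰·pairW wEta v u + 10¹⁷·pairW 1 v u
+ 10²¹·pairW (wGam α)(D_θv)(D_θu)`. Proved: linearity and locality of the pairings in `v`
(for `v ∈ C¹(strip)` against test functions `u`), the Cauchy–Schwarz bounds
`pairW ρ (S⊗G) u² ≤ (∫S²w²)(∫G²ρ)·sqW ρ u` and `pairW ρ (m·g) u² ≤ ‖m‖²_∞·sqW ρ g·sqW ρ u`, and the
restatements of the local block coercivity (`localBlockCoercivity_strong`) and of Corollary 6.11
(`h1Coercivity`) in this notation.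
-/

noncomputable section

open MeasureTheory Set Function Real Filter
open _root_.Topology

namespace Literature.Analysis.FluidPDE

namespace Elgindi

/-! ### The pairings -/

/-- The `η`-weight `sin(2θ)^{−η}`. [cite: Elgindi2021, §6.2 Definition 6.10 (p. 17 of arXiv:1904.04795)] -/
def wEta : ℝ → ℝ := fun θ => Real.sin (2 * θ) ^ (-eta)

/-- The `γ`-weight `sin(2θ)^{−γ}`, `γ = 1 + α/10`. [cite: Elgindi2021, §6.2 Definition 6.10 (p. 17 of arXiv:1904.04795)] -/
def wGam (α : ℝ) : ℝ → ℝ := fun θ => Real.sin (2 * θ) ^ (-gammaExp α)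

/-- The weighted pairing `∬_strip v·u·w²ρ(θ) dz dθ`. [cite: Elgindi2021, §6.2 Definition 6.10 (p. 17 of arXiv:1904.04795)] -/
def pairW (ρ : ℝ → ℝ) (v u : ℝ → ℝ → ℝ) : ℝ :=
  ∫ p in strip, v p.1 p.2 * u p.1 p.2 * radialWeight p.1 ^ 2 * ρ p.2

/-- The weighted square `∬_strip (uw)²ρ(θ) dz dθ`. [cite: Elgindi2021, §6.2 Definition 6.10 (p. 17 of arXiv:1904.04795)] -/
def sqW (ρ : ℝ → ℝ) (u : ℝ → ℝ → ℝ) : ℝ :=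
  ∫ p in strip, (u p.1 p.2 * radialWeight p.1) ^ 2 * ρ p.2

/-- **The `𝓗¹`-block pairing** of [Elgindi2021] Definition 6.10:
`10(D_zv, D_zu)_η + 10¹⁰(v,u)_η + 10¹⁷(v,u) + 10²¹(D_θv, D_θu)_γ`. [cite: Elgindi2021, §6.2 Definition 6.10 (p. 17 of arXiv:1904.04795)] -/
def blockPair (α : ℝ) (v u : ℝ → ℝ → ℝ) : ℝ :=
  10 * pairW wEta (Dz v) (Dz u) + 10 ^ 10 * pairW wEta v u + 10 ^ 17 * pairW (fun _ => 1) v u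
    + 10 ^ 21 * pairW (wGam α) (Dθ v) (Dθ u)

/-- Unfolding `pairW`. [folklore] -/
theorem pairW_def (ρ : ℝ → ℝ) (v u : ℝ → ℝ → ℝ) :
    pairW ρ v u = ∫ p in strip, v p.1 p.2 * u p.1 p.2 * radialWeight p.1 ^ 2 * ρ p.2 := rfl

/-- Unfolding `sqW`. [folklore] -/
theorem sqW_def (ρ : ℝ → ℝ) (u : ℝ → ℝ → ℝ) :
    sqW ρ u = ∫ p in strip, (u p.1 p.2 * radialWeight p.1) ^ 2 * ρ p.2 := rfl

/-- Unfolding `blockPair`. [folklore] -/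
theorem blockPair_def (α : ℝ) (v u : ℝ → ℝ → ℝ) :
    blockPair α v u = 10 * pairW wEta (Dz v) (Dz u) + 10 ^ 10 * pairW wEta v u
      + 10 ^ 17 * pairW (fun _ => 1) v u + 10 ^ 21 * pairW (wGam α) (Dθ v) (Dθ u) := rfl

/-- `sqW ρ u = pairW ρ u u`. [folklore] -/
theorem sqW_eq_pairW (ρ : ℝ → ℝ) (u : ℝ → ℝ → ℝ) : sqW ρ u = pairW ρ u u := by
  rw [sqW_def, pairW_def]
  exact integral_congr_ae (Filter.Eventually.of_forall fun p => by ring)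

/-! ### The admissible weights -/

/-- The three properties of a weight used below: nonnegative and continuous on the open quarter. [folklore] -/
structure IsWeight (ρ : ℝ → ℝ) : Prop where
  nonneg : ∀ θ ∈ Ioo 0 (π / 2), 0 ≤ ρ θ
  cont : ContinuousOn ρ (Ioo 0 (π / 2))

/-- The trivial weight. [folklore] -/
theorem isWeight_one : IsWeight fun _ => (1 : ℝ) := ⟨fun _ _ => zero_le_one, continuousOn_const⟩

/-- The `η`-weight is admissible. [folklore] -/
theorem isWeight_wEta : IsWeight wEta :=
  ⟨fun θ hθ => Real.rpow_nonneg (Real.sin_pos_of_pos_of_lt_pi (by linarith [hθ.1]) (by linarith [hθ.2])).le _,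
    (contDiffOn_sin_two_mul_rpow (-eta)).continuousOn⟩

/-- The `γ`-weight is admissible. [folklore] -/
theorem isWeight_wGam (α : ℝ) : IsWeight (wGam α) :=
  ⟨fun θ hθ => Real.rpow_nonneg (Real.sin_pos_of_pos_of_lt_pi (by linarith [hθ.1]) (by linarith [hθ.2])).le _,
    (contDiffOn_sin_two_mul_rpow (-gammaExp α)).continuousOn⟩

/-! ### Integrability against test functions -/

/-- A function continuous on the strip times a continuous function compactly supported inside the
open strip is integrable on the strip. [folklore] -/
theorem integrableOn_continuousOn_mul_test {c : ℝ × ℝ → ℝ} (hc : ContinuousOn c strip) {u : ℝ → ℝ → ℝ}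
    (huc : Continuous (uncurry u)) (hus : HasCompactSupport (uncurry u)) (husub : tsupport (uncurry u) ⊆ strip) :
    IntegrableOn (fun p : ℝ × ℝ => c p * u p.1 p.2) strip := by
  have hu0 : ∀ p : ℝ × ℝ, p ∉ tsupport (uncurry u) → u p.1 p.2 = 0 := fun p hp =>
    (image_eq_zero_of_notMem_tsupport hp : uncurry u p = 0)
  have hcont : Continuous fun p : ℝ × ℝ => c p * u p.1 p.2 :=
    continuous_of_continuousOn_strip (isClosed_tsupport _) husub (hc.mul huc.continuousOn) fun p hp => by
      simp [hu0 p hp]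
  exact (hcont.integrable_of_hasCompactSupport (HasCompactSupport.intro hus fun p hp => by
    simp [hu0 p hp])).integrableOn

/-- The radial weight is continuous on the strip. [folklore] -/
theorem continuousOn_radialWeight_strip : ContinuousOn (fun p : ℝ × ℝ => radialWeight p.1) strip := by
  unfold radialWeight
  exact ContinuousOn.div (by fun_prop) (by fun_prop) fun p hp => pow_ne_zero 2 (ne_of_gt hp.1)

/-- A weight lifted to the strip is continuous there. [folklore] -/
theorem IsWeight.continuousOn_strip {ρ : ℝ → ℝ} (hρ : IsWeight ρ) : ContinuousOn (fun p : ℝ × ℝ => ρ p.2) strip :=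
  hρ.cont.comp continuousOn_snd fun _ hp => hp.2

/-- The pairing integrand `v·u·w²ρ` is integrable on the strip for `v` continuous on the strip and
`u` a test function. [folklore] -/
theorem integrableOn_pairW {ρ : ℝ → ℝ} (hρ : IsWeight ρ) {v : ℝ → ℝ → ℝ}
    (hv : ContinuousOn (uncurry v) strip) {u : ℝ → ℝ → ℝ} (huc : Continuous (uncurry u))
    (hus : HasCompactSupport (uncurry u)) (husub : tsupport (uncurry u) ⊆ strip) :
    IntegrableOn (fun p : ℝ × ℝ => v p.1 p.2 * u p.1 p.2 * radialWeight p.1 ^ 2 * ρ p.2) strip := by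
  have hc : ContinuousOn (fun p : ℝ × ℝ => v p.1 p.2 * radialWeight p.1 ^ 2 * ρ p.2) strip :=
    (hv.mul (continuousOn_radialWeight_strip.pow 2)).mul hρ.continuousOn_strip
  exact (integrableOn_continuousOn_mul_test hc huc hus husub).congr_fun (fun p _ => by ring) measurableSet_strip

/-! ### Linearity and locality in the first slot -/

/-- `pairW` only sees the values of `v` on the strip. [folklore] -/
theorem pairW_congr_left {ρ : ℝ → ℝ} {v₁ v₂ : ℝ → ℝ → ℝ} (h : ∀ p ∈ strip, v₁ p.1 p.2 = v₂ p.1 p.2)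
    (u : ℝ → ℝ → ℝ) : pairW ρ v₁ u = pairW ρ v₂ u := by
  rw [pairW_def, pairW_def]
  exact setIntegral_congr_fun measurableSet_strip fun p hp => by rw [h p hp]

/-- Additivity of `pairW` in `v` (both `vᵢ` continuous on the strip, `u` a test function). [folklore] -/
theorem pairW_add_left {ρ : ℝ → ℝ} (hρ : IsWeight ρ) {v₁ v₂ : ℝ → ℝ → ℝ}
    (hv₁ : ContinuousOn (uncurry v₁) strip) (hv₂ : ContinuousOn (uncurry v₂) strip) {u : ℝ → ℝ → ℝ}
    (huc : Continuous (uncurry u)) (hus : HasCompactSupport (uncurry u)) (husub : tsupport (uncurry u) ⊆ strip) :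
    pairW ρ (v₁ + v₂) u = pairW ρ v₁ u + pairW ρ v₂ u := by
  rw [pairW_def, pairW_def, pairW_def, ← integral_add (integrableOn_pairW hρ hv₁ huc hus husub)
    (integrableOn_pairW hρ hv₂ huc hus husub)]
  exact integral_congr_ae (Filter.Eventually.of_forall fun p => by simp only [Pi.add_apply]; ring)

/-- Homogeneity of `pairW` in `v`. [folklore] -/
theorem pairW_smul_left (ρ : ℝ → ℝ) (a : ℝ) (v u : ℝ → ℝ → ℝ) : pairW ρ (a • v) u = a * pairW ρ v u := by
  rw [pairW_def, pairW_def, ← integral_const_mul]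
  exact integral_congr_ae (Filter.Eventually.of_forall fun p => by simp only [Pi.smul_apply, smul_eq_mul]; ring)

/-- `pairW` of a pointwise scalar multiple `fun z θ => a * v z θ`. [folklore] -/
theorem pairW_const_mul_left (ρ : ℝ → ℝ) (a : ℝ) (v u : ℝ → ℝ → ℝ) :
    pairW ρ (fun z θ => a * v z θ) u = a * pairW ρ v u :=
  pairW_smul_left ρ a v u

/-! ### Cauchy–Schwarz bounds -/

/-- The square root of a weight squares back on the quarter. [folklore] -/
theorem IsWeight.sq_sqrt {ρ : ℝ → ℝ} (hρ : IsWeight ρ) {p : ℝ × ℝ} (hp : p ∈ strip) :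
    Real.sqrt (ρ p.2) ^ 2 = ρ p.2 := Real.sq_sqrt (hρ.nonneg p.2 hp.2)

/-- **Cauchy–Schwarz for a separable left factor**: `pairW ρ (S⊗G) u² ≤ (∫₀^∞S²w²)(∫₀^{π/2}G²ρ)·sqW ρ u`
(`S`, `G` continuous on the open half-line/quarter with the displayed integrals finite, `u` a test
function). [cite: Elgindi2021, §6.3 proof of Proposition 6.13 (the Cauchy–Schwarz step) (p. 18 of arXiv:1904.04795)] -/
theorem sq_pairW_tensor_le {ρ : ℝ → ℝ} (hρ : IsWeight ρ) {S G : ℝ → ℝ} (hSc : ContinuousOn S (Ioi 0))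
    (hS : IntegrableOn (fun z => S z ^ 2 * radialWeight z ^ 2) (Ioi 0)) (hGc : ContinuousOn G (Ioo 0 (π / 2)))
    (hG : IntegrableOn (fun θ => G θ ^ 2 * ρ θ) (Ioo 0 (π / 2))) {u : ℝ → ℝ → ℝ} (huc : Continuous (uncurry u))
    (hus : HasCompactSupport (uncurry u)) (husub : tsupport (uncurry u) ⊆ strip) :
    pairW ρ (tensor S G) u ^ 2 ≤
      ((∫ z in Ioi 0, S z ^ 2 * radialWeight z ^ 2) * ∫ θ in Ioo 0 (π / 2), G θ ^ 2 * ρ θ) * sqW ρ u := by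
  set τ : ℝ × ℝ → ℝ := fun p => Real.sqrt (ρ p.2) with hτ
  set φ : ℝ × ℝ → ℝ := fun p => S p.1 * G p.2 * radialWeight p.1 * τ p with hφ
  set ψ : ℝ × ℝ → ℝ := fun p => u p.1 p.2 * radialWeight p.1 * τ p with hψ
  have eφψ : ∀ p ∈ strip, φ p * ψ p = tensor S G p.1 p.2 * u p.1 p.2 * radialWeight p.1 ^ 2 * ρ p.2 := by
    intro p hp
    rw [← hρ.sq_sqrt hp]
    simp only [hφ, hψ, hτ, tensor]
    ring
  have eφ2 : ∀ p ∈ strip, φ p ^ 2 = (S p.1 ^ 2 * radialWeight p.1 ^ 2) * (G p.2 ^ 2 * ρ p.2) := by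
    intro p hp
    rw [← hρ.sq_sqrt hp]
    simp only [hφ, hτ]
    ring
  have eψ2 : ∀ p ∈ strip, ψ p ^ 2 = (u p.1 p.2 * radialWeight p.1) ^ 2 * ρ p.2 := by
    intro p hp
    rw [← hρ.sq_sqrt hp]
    simp only [hψ, hτ]
    ring
  have hTc : ContinuousOn (uncurry (tensor S G)) strip :=
    ((hSc.comp continuousOn_fst fun p (hp : p ∈ strip) => hp.1).mul
      (hGc.comp continuousOn_snd fun p (hp : p ∈ strip) => hp.2)).congr fun p _ => rfl
  have iφψ : IntegrableOn (fun p => φ p * ψ p) strip :=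
    (integrableOn_pairW hρ hTc huc hus husub).congr_fun (fun p hp => (eφψ p hp).symm) measurableSet_strip
  have iφ2 : IntegrableOn (fun p => φ p ^ 2) strip := by
    have h := hS.mul_prod hG
    rw [← volume_restrict_strip] at h
    exact IntegrableOn.congr_fun h (fun p hp => (eφ2 p hp).symm) measurableSet_strip
  have iψ2 : IntegrableOn (fun p => ψ p ^ 2) strip := by
    have hc : ContinuousOn (fun p : ℝ × ℝ => u p.1 p.2 * radialWeight p.1 ^ 2 * ρ p.2) strip :=
      ((huc.continuousOn).mul (continuousOn_radialWeight_strip.pow 2)).mul hρ.continuousOn_strip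
    refine (integrableOn_continuousOn_mul_test hc huc hus husub).congr_fun (fun p hp => ?_) measurableSet_strip
    rw [eψ2 p hp]; ring
  have hCS := sq_integral_mul_le iφ2 iψ2 iφψ
  have hφ2 : ∫ p in strip, φ p ^ 2 = (∫ z in Ioi 0, S z ^ 2 * radialWeight z ^ 2) * ∫ θ in Ioo 0 (π / 2), G θ ^ 2 * ρ θ := by
    rw [setIntegral_congr_fun measurableSet_strip eφ2, volume_restrict_strip,
      integral_prod_mul (f := fun z : ℝ => S z ^ 2 * radialWeight z ^ 2) (g := fun θ : ℝ => G θ ^ 2 * ρ θ)]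
  have eT : pairW ρ (tensor S G) u = ∫ p in strip, φ p * ψ p := by
    rw [pairW_def]; exact (setIntegral_congr_fun measurableSet_strip eφψ).symm
  have eU : ∫ p in strip, ψ p ^ 2 = sqW ρ u := by rw [sqW_def]; exact setIntegral_congr_fun measurableSet_strip eψ2
  rw [eT, ← eU, ← hφ2]
  exact hCS

/-- **Cauchy–Schwarz for a bounded radial multiplier**: `pairW ρ (m·g) u² ≤ M²·sqW ρ g·sqW ρ u` when
`|m| ≤ M` on `(0, ∞)` (`m` continuous there, `g`, `u` test functions). [cite: Elgindi2021, §6.3 proof of Proposition 6.13 (p. 18 of arXiv:1904.04795)] -/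
theorem sq_pairW_radialMul_le {ρ : ℝ → ℝ} (hρ : IsWeight ρ) {m : ℝ → ℝ} {M : ℝ} (hmc : ContinuousOn m (Ioi 0))
    (hM : ∀ z ∈ Ioi (0 : ℝ), |m z| ≤ M) {g : ℝ → ℝ → ℝ} (hgc : Continuous (uncurry g))
    (hgs : HasCompactSupport (uncurry g)) (hgsub : tsupport (uncurry g) ⊆ strip) {u : ℝ → ℝ → ℝ}
    (huc : Continuous (uncurry u)) (hus : HasCompactSupport (uncurry u)) (husub : tsupport (uncurry u) ⊆ strip) :
    pairW ρ (radialMul m g) u ^ 2 ≤ M ^ 2 * sqW ρ g * sqW ρ u := by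
  set τ : ℝ × ℝ → ℝ := fun p => Real.sqrt (ρ p.2) with hτ
  set φ : ℝ × ℝ → ℝ := fun p => m p.1 * g p.1 p.2 * radialWeight p.1 * τ p with hφ
  set ψ : ℝ × ℝ → ℝ := fun p => u p.1 p.2 * radialWeight p.1 * τ p with hψ
  have eφψ : ∀ p ∈ strip, φ p * ψ p = radialMul m g p.1 p.2 * u p.1 p.2 * radialWeight p.1 ^ 2 * ρ p.2 := by
    intro p hp
    rw [← hρ.sq_sqrt hp]
    simp only [hφ, hψ, hτ, radialMul_apply]
    ring
  have eφ2 : ∀ p ∈ strip, φ p ^ 2 = m p.1 ^ 2 * ((g p.1 p.2 * radialWeight p.1) ^ 2 * ρ p.2) := by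
    intro p hp
    rw [← hρ.sq_sqrt hp]
    simp only [hφ, hτ]
    ring
  have eψ2 : ∀ p ∈ strip, ψ p ^ 2 = (u p.1 p.2 * radialWeight p.1) ^ 2 * ρ p.2 := by
    intro p hp
    rw [← hρ.sq_sqrt hp]
    simp only [hψ, hτ]
    ring
  have hMc : ContinuousOn (uncurry (radialMul m g)) strip :=
    ((hmc.comp continuousOn_fst fun p (hp : p ∈ strip) => hp.1).mul hgc.continuousOn).congr fun p _ => rfl
  have iφψ : IntegrableOn (fun p => φ p * ψ p) strip :=
    (integrableOn_pairW hρ hMc huc hus husub).congr_fun (fun p hp => (eφψ p hp).symm) measurableSet_strip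
  have iG : IntegrableOn (fun p : ℝ × ℝ => (g p.1 p.2 * radialWeight p.1) ^ 2 * ρ p.2) strip := by
    have hc : ContinuousOn (fun p : ℝ × ℝ => g p.1 p.2 * radialWeight p.1 ^ 2 * ρ p.2) strip :=
      ((hgc.continuousOn).mul (continuousOn_radialWeight_strip.pow 2)).mul hρ.continuousOn_strip
    exact (integrableOn_continuousOn_mul_test hc hgc hgs hgsub).congr_fun (fun p _ => by ring) measurableSet_strip
  have iφ2 : IntegrableOn (fun p => φ p ^ 2) strip := by
    have hc : ContinuousOn (fun p : ℝ × ℝ => m p.1 ^ 2 * (g p.1 p.2 * radialWeight p.1 ^ 2 * ρ p.2)) strip :=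
      (((hmc.comp continuousOn_fst fun p (hp : p ∈ strip) => hp.1).pow 2).mul
        (((hgc.continuousOn).mul (continuousOn_radialWeight_strip.pow 2)).mul hρ.continuousOn_strip))
    refine (integrableOn_continuousOn_mul_test hc hgc hgs hgsub).congr_fun (fun p hp => ?_) measurableSet_strip
    rw [eφ2 p hp]; ring
  have iψ2 : IntegrableOn (fun p => ψ p ^ 2) strip := by
    have hc : ContinuousOn (fun p : ℝ × ℝ => u p.1 p.2 * radialWeight p.1 ^ 2 * ρ p.2) strip :=
      ((huc.continuousOn).mul (continuousOn_radialWeight_strip.pow 2)).mul hρ.continuousOn_strip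
    refine (integrableOn_continuousOn_mul_test hc huc hus husub).congr_fun (fun p hp => ?_) measurableSet_strip
    rw [eψ2 p hp]; ring
  have hCS := sq_integral_mul_le iφ2 iψ2 iφψ
  have hφ2le : ∫ p in strip, φ p ^ 2 ≤ M ^ 2 * sqW ρ g := by
    rw [sqW_def, ← integral_const_mul]
    refine setIntegral_mono_on iφ2 (iG.const_mul _) measurableSet_strip fun p hp => ?_
    rw [eφ2 p hp]
    have h0 : 0 ≤ (g p.1 p.2 * radialWeight p.1) ^ 2 * ρ p.2 := mul_nonneg (sq_nonneg _) (hρ.nonneg p.2 hp.2)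
    have hm2 : m p.1 ^ 2 ≤ M ^ 2 := by
      rw [← sq_abs]; exact pow_le_pow_left₀ (abs_nonneg _) (hM p.1 hp.1) 2
    exact mul_le_mul_of_nonneg_right hm2 h0
  have hU0 : 0 ≤ sqW ρ u := by
    rw [sqW_def]
    exact setIntegral_nonneg measurableSet_strip fun p hp => mul_nonneg (sq_nonneg _) (hρ.nonneg p.2 hp.2)
  have eT : pairW ρ (radialMul m g) u = ∫ p in strip, φ p * ψ p := by
    rw [pairW_def]; exact (setIntegral_congr_fun measurableSet_strip eφψ).symm
  have eU : ∫ p in strip, ψ p ^ 2 = sqW ρ u := by rw [sqW_def]; exact setIntegral_congr_fun measurableSet_strip eψ2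
  rw [eT]
  rw [eU] at hCS
  calc (∫ p in strip, φ p * ψ p) ^ 2 ≤ (∫ p in strip, φ p ^ 2) * sqW ρ u := hCS
    _ ≤ (M ^ 2 * sqW ρ g) * sqW ρ u := mul_le_mul_of_nonneg_right hφ2le hU0
    _ = M ^ 2 * sqW ρ g * sqW ρ u := by ring

/-- **Plain Cauchy–Schwarz**: `pairW ρ g u² ≤ sqW ρ g·sqW ρ u` for test functions `g`, `u`. [folklore] -/
theorem sq_pairW_le {ρ : ℝ → ℝ} (hρ : IsWeight ρ) {g : ℝ → ℝ → ℝ} (hgc : Continuous (uncurry g))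
    (hgs : HasCompactSupport (uncurry g)) (hgsub : tsupport (uncurry g) ⊆ strip) {u : ℝ → ℝ → ℝ}
    (huc : Continuous (uncurry u)) (hus : HasCompactSupport (uncurry u)) (husub : tsupport (uncurry u) ⊆ strip) :
    pairW ρ g u ^ 2 ≤ sqW ρ g * sqW ρ u := by
  have h := sq_pairW_radialMul_le hρ (m := fun _ => (1 : ℝ)) (M := 1) continuousOn_const
    (fun z _ => by simp) hgc hgs hgsub huc hus husub
  have e : radialMul (fun _ => (1 : ℝ)) g = g := by funext z θ; simp [radialMul_apply]
  rw [e] at h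
  simpa using h

/-! ### Nonnegativity of the weighted squares -/

/-- `0 ≤ sqW ρ u` for an admissible weight. [folklore] -/
theorem sqW_nonneg {ρ : ℝ → ℝ} (hρ : IsWeight ρ) (u : ℝ → ℝ → ℝ) : 0 ≤ sqW ρ u := by
  rw [sqW_def]
  exact setIntegral_nonneg measurableSet_strip fun p hp => mul_nonneg (sq_nonneg _) (hρ.nonneg p.2 hp.2)

/-! ### The two coercivity inputs in block notation -/

/-- **The local block coercivity, strong form, in block notation** (`0 ≤ α ≤ 1`, `u ∈ C³` compactly
supported inside the open strip): `(39/10)sqW_η(D_zu) + 4·10⁹sqW_η(u) + 4·10¹⁶sqW_1(u) +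
10²⁰sqW_γ(D_θu) ≤ blockPair α (𝓛₀u) u`. [cite: Elgindi2021, §6.2 Definition 6.10 and §6.3 proof of Proposition 6.13 (pp. 17–18 of arXiv:1904.04795)] -/
theorem localBlockCoercivity_block {α : ℝ} (hα : 0 ≤ α) (hα1 : α ≤ 1) {u : ℝ → ℝ → ℝ}
    (hu : ContDiff ℝ 3 (uncurry u)) (hs : HasCompactSupport (uncurry u)) (hsub : tsupport (uncurry u) ⊆ strip) :
    39 / 10 * sqW wEta (Dz u) + 4 * 10 ^ 9 * sqW wEta u + 4 * 10 ^ 16 * sqW (fun _ => 1) u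
        + 10 ^ 20 * sqW (wGam α) (Dθ u) ≤ blockPair α (opLT0 u) u := by
  have h := localBlockCoercivity_strong hα hα1 hu hs hsub
  have e1 : sqW (fun _ => (1 : ℝ)) u = ∫ p in strip, (u p.1 p.2 * radialWeight p.1) ^ 2 := by
    rw [sqW_def]; exact integral_congr_ae (Filter.Eventually.of_forall fun p => by simp)
  have e2 : pairW (fun _ => (1 : ℝ)) (opLT0 u) u = ∫ p in strip, opLT0 u p.1 p.2 * u p.1 p.2 * radialWeight p.1 ^ 2 := by
    rw [pairW_def]; exact integral_congr_ae (Filter.Eventually.of_forall fun p => by simp)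
  simp only [blockPair_def, sqW_def, pairW_def, wEta, wGam] at e1 e2 ⊢
  rw [e1, e2]
  exact h

/-- **Corollary 6.11 in block notation** (`0 < α ≤ 10⁻¹⁴`, `f ∈ C³` compactly supported inside the
open strip, `L₁₂(f)(0) = 0`): `sqW_η(f) + sqW_η(D_zf) + sqW_γ(D_θf) ≤ blockPair α (𝓛_Γ^Tf) f`. [cite: Elgindi2021, §6.2 Corollary 6.11 (p. 17 of arXiv:1904.04795)] -/
theorem h1Coercivity_block {α : ℝ} (hα : 0 < α) (hα14 : α ≤ 1 / 10 ^ 14) {f : ℝ → ℝ → ℝ}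
    (hf : ContDiff ℝ 3 (uncurry f)) (hs : HasCompactSupport (uncurry f))
    (hsub : tsupport (uncurry f) ⊆ strip) (hL0 : L12 f 0 = 0) :
    sqW wEta f + sqW wEta (Dz f) + sqW (wGam α) (Dθ f) ≤ blockPair α (opLΓT α f) f := by
  have h := h1Coercivity hα hα14 hf hs hsub hL0
  have e2 : pairW (fun _ => (1 : ℝ)) (opLΓT α f) f = ∫ p in strip, opLΓT α f p.1 p.2 * f p.1 p.2 * radialWeight p.1 ^ 2 := by
    rw [pairW_def]; exact integral_congr_ae (Filter.Eventually.of_forall fun p => by simp)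
  simp only [blockPair_def, sqW_def, pairW_def, wEta, wGam] at e2 ⊢
  rw [e2]
  exact h

/-! ### The `Λ`-scaled blocks -/

/-- **The `Λ`-scaled block** `10(D_zv,D_zu)_η + Λ·(10¹⁰(v,u)_η + 10¹⁷(v,u) + 10²¹(D_θv,D_θu)_γ)`: the
block of Definition 6.10 with its three lower-order pairings scaled by a factor `Λ ≥ 1` (the freedom
"`c_{1,k}, c_{2,k} ≥ 1` will be chosen depending on `k` only" of the proof of Prop. 6.13, used here
inside the block; Elgindi–Ghoul–Masmoudi's Proposition 3.2 only asserts the existence of such an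
inner product). [cite: Elgindi2021, §6.3 proof of Proposition 6.13 (p. 18 of arXiv:1904.04795); ElgindiGhoulMasmoudi2021, §3.1 Proposition 3.2 (p. 10 of arXiv:1910.14071)] -/
def blockΛ (α Λ : ℝ) (v u : ℝ → ℝ → ℝ) : ℝ :=
  10 * pairW wEta (Dz v) (Dz u)
    + Λ * (10 ^ 10 * pairW wEta v u + 10 ^ 17 * pairW (fun _ => 1) v u + 10 ^ 21 * pairW (wGam α) (Dθ v) (Dθ u))

/-- Unfolding `blockΛ`. [folklore] -/
theorem blockΛ_def (α Λ : ℝ) (v u : ℝ → ℝ → ℝ) :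
    blockΛ α Λ v u = 10 * pairW wEta (Dz v) (Dz u)
      + Λ * (10 ^ 10 * pairW wEta v u + 10 ^ 17 * pairW (fun _ => 1) v u + 10 ^ 21 * pairW (wGam α) (Dθ v) (Dθ u)) := rfl

/-- `blockΛ α 1 = blockPair α`. [folklore] -/
theorem blockΛ_one (α : ℝ) (v u : ℝ → ℝ → ℝ) : blockΛ α 1 v u = blockPair α v u := by
  rw [blockΛ_def, blockPair_def]; ring

/-- **Local block coercivity, `Λ`-scaled** (`0 ≤ α ≤ 1`, `Λ ≥ 1`, `u ∈ C³` compactly supported inside the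
open strip): `(39/10)sqW_η(D_zu) + Λ(4·10⁹sqW_η(u) + 4·10¹⁶sqW_1(u) + 10²⁰sqW_γ(D_θu)) ≤ blockΛ α Λ (𝓛₀u) u`
(the `η`- and `γ`-pairings of `𝓛₀` are nonnegative, the unweighted one is covered by the `γ`-one). [cite: Elgindi2021, §6.3 proof of Proposition 6.13 (p. 18 of arXiv:1904.04795)] -/
theorem localBlockΛ {α Λ : ℝ} (hα : 0 ≤ α) (hα1 : α ≤ 1) (hΛ : 1 ≤ Λ) {u : ℝ → ℝ → ℝ}
    (hu : ContDiff ℝ 3 (uncurry u)) (hs : HasCompactSupport (uncurry u)) (hsub : tsupport (uncurry u) ⊆ strip) :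
    39 / 10 * sqW wEta (Dz u) + Λ * (4 * 10 ^ 9 * sqW wEta u + 4 * 10 ^ 16 * sqW (fun _ => 1) u
        + 10 ^ 20 * sqW (wGam α) (Dθ u)) ≤ blockΛ α Λ (opLT0 u) u := by
  have hu2 : ContDiff ℝ 2 (uncurry u) := hu.of_le (by norm_num)
  have hu1 : ContDiff ℝ 1 (uncurry u) := hu.of_le (by norm_num)
  have hd := Dz_opLT0_pairing_ge hα hu hs hsub
  have he := opLT0_pairing_eta_ge hu2 hs hsub
  have h0 := opLT0_pairing_ge hu1 hs hsub
  have ht := Dθ_opLT0_pairing_ge hα hu2 hs hsub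
  have hYw := integral_sq_Dθ_le_weighted hα hu2 hs hsub
  have hAX := integral_sq_le_weighted_eta hu2 hs hsub
  have e1 : sqW (fun _ => (1 : ℝ)) u = ∫ p in strip, (u p.1 p.2 * radialWeight p.1) ^ 2 := by
    rw [sqW_def]; exact integral_congr_ae (Filter.Eventually.of_forall fun p => by simp)
  have e2 : pairW (fun _ => (1 : ℝ)) (opLT0 u) u = ∫ p in strip, opLT0 u p.1 p.2 * u p.1 p.2 * radialWeight p.1 ^ 2 := by
    rw [pairW_def]; exact integral_congr_ae (Filter.Eventually.of_forall fun p => by simp)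
  simp only [blockΛ_def, sqW_def, pairW_def, wEta, wGam] at e1 e2 ⊢
  rw [e1, e2]
  set X : ℝ := ∫ p in strip, (u p.1 p.2 * radialWeight p.1) ^ 2 * Real.sin (2 * p.2) ^ (-eta) with hX
  set Y : ℝ := ∫ p in strip, (Dθ u p.1 p.2 * radialWeight p.1) ^ 2 * Real.sin (2 * p.2) ^ (-gammaExp α) with hY
  set Z : ℝ := ∫ p in strip, (Dz u p.1 p.2 * radialWeight p.1) ^ 2 * Real.sin (2 * p.2) ^ (-eta) with hZ
  set A : ℝ := ∫ p in strip, (u p.1 p.2 * radialWeight p.1) ^ 2 with hA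
  set Yw : ℝ := ∫ p in strip, (Dθ u p.1 p.2 * radialWeight p.1) ^ 2 with hYw'
  set Pz : ℝ := ∫ p in strip, Dz (opLT0 u) p.1 p.2 * Dz u p.1 p.2 * radialWeight p.1 ^ 2 * Real.sin (2 * p.2) ^ (-eta) with hPz
  set Pe : ℝ := ∫ p in strip, opLT0 u p.1 p.2 * u p.1 p.2 * radialWeight p.1 ^ 2 * Real.sin (2 * p.2) ^ (-eta) with hPe
  set P1 : ℝ := ∫ p in strip, opLT0 u p.1 p.2 * u p.1 p.2 * radialWeight p.1 ^ 2 with hP1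
  set Pg : ℝ := ∫ p in strip, Dθ (opLT0 u) p.1 p.2 * Dθ u p.1 p.2 * radialWeight p.1 ^ 2 *
    Real.sin (2 * p.2) ^ (-gammaExp α) with hPg
  have hA0 : 0 ≤ A := integral_nonneg fun p => sq_nonneg _
  have hX0 : 0 ≤ X := hA0.trans hAX
  have hY0 : 0 ≤ Y := by
    simp only [hY]
    refine setIntegral_nonneg measurableSet_strip fun p hp => ?_
    have hsθ : 0 < Real.sin (2 * p.2) := Real.sin_pos_of_pos_of_lt_pi (by linarith [hp.2.1]) (by linarith [hp.2.2])
    exact mul_nonneg (sq_nonneg _) (Real.rpow_nonneg hsθ.le _)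
  have hΛ0 : 0 ≤ Λ := zero_le_one.trans hΛ
  -- the three scaled pairings combined are nonnegative up to the displayed quantities
  have hcomb : 47 / 10 * 10 ^ 9 * X + 465 / 1000 * 10 ^ 17 * A + (10 ^ 21 * (1 / 2 - 3 * α / 10) - 450 / 7 * 10 ^ 17) * Y ≤
      10 ^ 10 * Pe + 10 ^ 17 * P1 + 10 ^ 21 * Pg := by nlinarith [he, h0, ht, hYw]
  have hcombΛ := mul_le_mul_of_nonneg_left hcomb hΛ0
  have hαY : α * Y ≤ 1 * Y := mul_le_mul_of_nonneg_right hα1 hY0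
  have hΛX : X ≤ Λ * X := le_mul_of_one_le_left hX0 hΛ
  have hΛY : Y ≤ Λ * Y := le_mul_of_one_le_left hY0 hΛ
  have hΛαY : Λ * (α * Y) ≤ Λ * (1 * Y) := mul_le_mul_of_nonneg_left hαY hΛ0
  nlinarith [hd, hcombΛ, hΛX, hΛY, hΛαY, hA0, hX0, hY0, hΛ0, mul_nonneg hΛ0 hA0, mul_nonneg hΛ0 hX0, mul_nonneg hΛ0 hY0]

/-- **Base-word block coercivity, `Λ`-scaled** (`0 < α ≤ 10⁻¹⁴`, `Λ ≥ 1`, `f ∈ C³` compactly supported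
inside the open strip, `L₁₂(f)(0) = 0`): `sqW_η(D_zf) + Λ(10⁹sqW_η(f) + 10¹⁵sqW_1(f) + 10²⁰sqW_γ(D_θf)) ≤
blockΛ α Λ (𝓛_Γ^Tf) f` (Props. 6.4, 6.5, 6.7, 6.9 combined as in Cor. 6.11). [cite: Elgindi2021, §6.2 Corollary 6.11 (p. 17 of arXiv:1904.04795)] -/
theorem baseBlockΛ {α Λ : ℝ} (hα : 0 < α) (hα14 : α ≤ 1 / 10 ^ 14) (hΛ : 1 ≤ Λ) {f : ℝ → ℝ → ℝ}
    (hf : ContDiff ℝ 3 (uncurry f)) (hs : HasCompactSupport (uncurry f))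
    (hsub : tsupport (uncurry f) ⊆ strip) (hL0 : L12 f 0 = 0) :
    sqW wEta (Dz f) + Λ * (10 ^ 9 * sqW wEta f + 10 ^ 15 * sqW (fun _ => 1) f + 10 ^ 20 * sqW (wGam α) (Dθ f)) ≤
      blockΛ α Λ (opLΓT α f) f := by
  have hα' : α ≤ 1 / 200 := hα14.trans (by norm_num)
  have hf2 : ContDiff ℝ 2 (uncurry f) := hf.of_le (by norm_num)
  have h69 := radialDerivativeCoercivity hα hα' hf hs hsub hL0
  have h67 := etaWeightedCoercivity hα hα' hf2 hs hsub hL0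
  have h64 := transportL2Coercivity hα.le hα' (hf.of_le (by norm_num)) hs hsub hL0
  have h65 := thetaDerivativeCoercivity hα hα' hf2 hs hsub hL0
  have hYw := integral_sq_Dθ_le_weighted hα.le hf2 hs hsub
  have hAX := integral_sq_le_weighted_eta hf2 hs hsub
  have e1 : sqW (fun _ => (1 : ℝ)) f = ∫ p in strip, (f p.1 p.2 * radialWeight p.1) ^ 2 := by
    rw [sqW_def]; exact integral_congr_ae (Filter.Eventually.of_forall fun p => by simp)
  have e2 : pairW (fun _ => (1 : ℝ)) (opLΓT α f) f = ∫ p in strip, opLΓT α f p.1 p.2 * f p.1 p.2 * radialWeight p.1 ^ 2 := by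
    rw [pairW_def]; exact integral_congr_ae (Filter.Eventually.of_forall fun p => by simp)
  simp only [blockΛ_def, sqW_def, pairW_def, wEta, wGam] at e1 e2 ⊢
  rw [e1, e2]
  set X : ℝ := ∫ p in strip, (f p.1 p.2 * radialWeight p.1) ^ 2 * Real.sin (2 * p.2) ^ (-eta) with hX
  set Y : ℝ := ∫ p in strip, (Dθ f p.1 p.2 * radialWeight p.1) ^ 2 * Real.sin (2 * p.2) ^ (-gammaExp α) with hY
  set Z : ℝ := ∫ p in strip, (Dz f p.1 p.2 * radialWeight p.1) ^ 2 * Real.sin (2 * p.2) ^ (-eta) with hZ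
  set A : ℝ := ∫ p in strip, (f p.1 p.2 * radialWeight p.1) ^ 2 with hA
  set Yw : ℝ := ∫ p in strip, (Dθ f p.1 p.2 * radialWeight p.1) ^ 2 with hYw'
  set P9 : ℝ := ∫ p in strip, Dz (opLΓT α f) p.1 p.2 * Dz f p.1 p.2 * radialWeight p.1 ^ 2 * Real.sin (2 * p.2) ^ (-eta) with hP9
  set P7 : ℝ := ∫ p in strip, opLΓT α f p.1 p.2 * f p.1 p.2 * radialWeight p.1 ^ 2 * Real.sin (2 * p.2) ^ (-eta) with hP7
  set P4 : ℝ := ∫ p in strip, opLΓT α f p.1 p.2 * f p.1 p.2 * radialWeight p.1 ^ 2 with hP4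
  set P5 : ℝ := ∫ p in strip, Dθ (opLΓT α f) p.1 p.2 * Dθ f p.1 p.2 * radialWeight p.1 ^ 2 *
    Real.sin (2 * p.2) ^ (-gammaExp α) with hP5
  have hA0 : 0 ≤ A := integral_nonneg fun p => sq_nonneg _
  have hX0 : 0 ≤ X := hA0.trans hAX
  have hY0 : 0 ≤ Y := by
    simp only [hY]
    refine setIntegral_nonneg measurableSet_strip fun p hp => ?_
    have hsθ : 0 < Real.sin (2 * p.2) := Real.sin_pos_of_pos_of_lt_pi (by linarith [hp.2.1]) (by linarith [hp.2.2])
    exact mul_nonneg (sq_nonneg _) (Real.rpow_nonneg hsθ.le _)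
  have hΛ0 : 0 ≤ Λ := zero_le_one.trans hΛ
  have hαA : α * A ≤ 1 / 10 ^ 14 * A := mul_le_mul_of_nonneg_right hα14 hA0
  have hαY : α * Y ≤ 1 / 10 ^ 14 * Y := mul_le_mul_of_nonneg_right hα14 hY0
  have hZ0 : 0 ≤ Z := by
    simp only [hZ]
    refine setIntegral_nonneg measurableSet_strip fun p hp => ?_
    have hsθ : 0 < Real.sin (2 * p.2) := Real.sin_pos_of_pos_of_lt_pi (by linarith [hp.2.1]) (by linarith [hp.2.2])
    exact mul_nonneg (sq_nonneg _) (Real.rpow_nonneg hsθ.le _)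
  have hcomb : 2 * 10 ^ 9 * X + 9 * 10 ^ 15 * A + 23 * 10 ^ 19 * Y ≤ 10 ^ 10 * P7 + 10 ^ 17 * P4 + 10 ^ 21 * P5 := by
    nlinarith [h67, h64, h65, hYw, hAX, hαA, hαY, hA0, hX0, hY0]
  have hcombΛ : 2 * 10 ^ 9 * (Λ * X) + 9 * 10 ^ 15 * (Λ * A) + 23 * 10 ^ 19 * (Λ * Y) ≤
      Λ * (10 ^ 10 * P7 + 10 ^ 17 * P4 + 10 ^ 21 * P5) := by
    calc 2 * 10 ^ 9 * (Λ * X) + 9 * 10 ^ 15 * (Λ * A) + 23 * 10 ^ 19 * (Λ * Y)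
        = Λ * (2 * 10 ^ 9 * X + 9 * 10 ^ 15 * A + 23 * 10 ^ 19 * Y) := by ring
      _ ≤ _ := mul_le_mul_of_nonneg_left hcomb hΛ0
  have hΛX : X ≤ Λ * X := le_mul_of_one_le_left hX0 hΛ
  have hΛY : Y ≤ Λ * Y := le_mul_of_one_le_left hY0 hΛ
  have hΛA : 0 ≤ Λ * A := mul_nonneg hΛ0 hA0
  have key : Z + (10 ^ 9 * (Λ * X) + 10 ^ 15 * (Λ * A) + 10 ^ 20 * (Λ * Y)) ≤
      10 * P9 + Λ * (10 ^ 10 * P7 + 10 ^ 17 * P4 + 10 ^ 21 * P5) := by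
    linarith [h69, hcombΛ, hΛX, hΛY, hΛA, hZ0, hX0, hY0]
  calc Z + Λ * (10 ^ 9 * X + 10 ^ 15 * A + 10 ^ 20 * Y)
      = Z + (10 ^ 9 * (Λ * X) + 10 ^ 15 * (Λ * A) + 10 ^ 20 * (Λ * Y)) := by ring
    _ ≤ _ := key

end Elgindi


end Literature.Analysis.FluidPDE
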